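import Summits.ValiantsHypothesis.ValiantsHypothesis.Theorems.LacunarySymmetroidMatrixDescartesKernelDefiniteJunctionBivariateEval
import Summits.ValiantsHypothesis.ValiantsHypothesis.Theorems.LacunarySymmetroidMatrixDescartesKernelDefiniteJunctionSeamLimit

/-!
# Kernel-definite junction, part 8c: the seam datum of the junction pencil

Helper file for the stub `stub_kernelDefiniteJunction` of the line `junction_ceiling` (crux `MatrixDescartes`,
stmt-ValiantsHypothesis-18050).  Combines the scaling limit (8a) with the coefficient reader (8b) for the bivariate
determinant `G = det 𝓗` of the junction (parts 5–6), with the junction letter diagonalised as `J = U diag(λ) Uᵀ`: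
* `seam_limit_F` — the limit of 8a rewritten on the coefficient array `F i j = [x^i y^j] G`:
  `z^{-M} ∑ F i j v^j z^{w i + g (J − j)} → det N∞(v)`, `M = w n₀ + g J`, `n₀ = ∑_i (λ_i = 0 ? ã' : ã)`;
* `det_Ninf` — `det N∞(v) = D · φ(v^w)` with `D = ∏_{λ_i ≠ 0} λ_i` and `φ(s) = det (A' + s B')`, the compressions
  `A' = (Uᵀ S last' U)|_{λ = 0}`, `B' = (Uᵀ T 1 U)|_{λ = 0}` (block-triangular determinant);
* `seam_vanish` / `seam_critical` — above the seam line the coefficients of `G` vanish, and on it they are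
  `D · [expand_w φ]_j`.
[folklore]
-/

-- `Summit.ValiantsHypothesis.ValiantsHypothesis.…` is the tree's mandated single-conjunct layout (Sub = Summit).
set_option linter.dupNamespace false
set_option autoImplicit false

namespace Summit.ValiantsHypothesis.ValiantsHypothesis.Theorems.LacunarySymmetroidMatrixDescartes.JunctionCeiling

open Polynomial Finset Matrix Filter Topology
open scoped BigOperators

/-! ## 1. The block determinant `det N∞(v) = D · φ(v^w)` -/

/-- evaluation of the compression pencil `φ = det (C A' + X C B')`. [folklore] -/
theorem eval_det_affine {n : Type*} [Fintype n] [DecidableEq n] (A B : Matrix n n ℝ) (s : ℝ) :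
    (det (Matrix.of fun i k : n => C (A i k) + X * C (B i k))).eval s = det (A + s • B) := by
  rw [← coe_evalRingHom, RingHom.map_det, RingHom.mapMatrix_apply]
  congr 1
  ext i k
  simp only [Matrix.map_apply, Matrix.of_apply, coe_evalRingHom, eval_add, eval_mul, eval_C, eval_X,
    Matrix.add_apply, Matrix.smul_apply, smul_eq_mul]

/-- **block determinant** of the limit matrix `N∞(v)`. [folklore] -/
theorem det_Ninf {m : ℕ} (lam : Fin m → ℝ) (A B : Matrix (Fin m) (Fin m) ℝ) (s : ℝ) :
    (Matrix.of (fun i k : Fin m => if lam i = 0 then A i k + s * B i k else (if i = k then lam i else 0))).det =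
      (det (Matrix.of fun i k : {i : Fin m // lam i = 0} => C (A i.1 k.1) + X * C (B i.1 k.1))).eval s *
        ∏ i : {i : Fin m // ¬ lam i = 0}, lam i.1 := by
  rw [Matrix.twoBlockTriangular_det _ (fun i => lam i = 0)]
  · congr 1
    · rw [eval_det_affine]
      congr 1
      ext i k
      simp [Matrix.toSquareBlockProp_def, i.2]
    · have h : (Matrix.of (fun i k : Fin m => if lam i = 0 then A i k + s * B i k
          else (if i = k then lam i else 0))).toSquareBlockProp (fun i => ¬ lam i = 0) =
          diagonal (fun i : {i : Fin m // ¬ lam i = 0} => lam i.1) := by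
        ext i k
        simp only [Matrix.toSquareBlockProp_def, Matrix.of_apply, if_neg i.2, diagonal_apply]
        by_cases hik : i = k
        · subst hik; simp
        · rw [if_neg (fun h => hik (Subtype.ext h)), if_neg hik]
      rw [h, det_diagonal]
  · intro i hi k hk
    rw [Matrix.of_apply, if_neg hi, if_neg]
    intro hik
    rw [hik] at hi
    exact hi hk

/-! ## 2. The seam limit on the coefficient array -/

section Seam

variable {m : ℕ} (K₁ K₂ : ℕ) (d : Fin (K₁ + 2) → ℕ) (S : Fin (K₁ + 2) → Matrix (Fin m) (Fin m) ℝ)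
  (e : Fin (K₂ + 2) → ℕ) (T : Fin (K₂ + 2) → Matrix (Fin m) (Fin m) ℝ)
  (H : Matrix (Fin m) (Fin m) (Polynomial ℝ[X]))
  (hH : ∀ i k, H i k = (∑ l : Fin (K₁ + 2), C (C (S l i k)) * X ^ (d l - d 0)) +
    ∑ l : Fin (K₂ + 1), C (C (T l.succ i k) * X ^ (e l.succ - e 0)) * X ^ (d (Fin.last (K₁ + 1)) - d 0))
  (U : Matrix (Fin m) (Fin m) ℝ) (lam : Fin m → ℝ)

include hH

/-- **the seam limit on the coefficient array** `F i j = [x^i y^j] det 𝓗`. [folklore] -/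
theorem seam_limit_F (hd : StrictMono d) (he : StrictMono e) (hU : U * Uᵀ = 1)
    (hJ : S (Fin.last (K₁ + 1)) = U * diagonal lam * Uᵀ) (v : ℝ) :
    Tendsto (fun z : ℝ =>
      (∑ i ∈ range (m * (d (Fin.last (K₁ + 1)) - d 0) + 1), ∑ j ∈ range (m * (e (Fin.last (K₂ + 1)) - e 0) + 1),
        ((det H).coeff i).coeff j * v ^ j *
          z ^ ((e 1 - e 0) * i + (d (Fin.last (K₁ + 1)) - d (Fin.last K₁).castSucc) *
            (m * (e (Fin.last (K₂ + 1)) - e 0) - j))) *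
      (z ^ ((e 1 - e 0) * (∑ i, (if lam i = 0 then d (Fin.last K₁).castSucc - d 0 else d (Fin.last (K₁ + 1)) - d 0)) +
        (d (Fin.last (K₁ + 1)) - d (Fin.last K₁).castSucc) * (m * (e (Fin.last (K₂ + 1)) - e 0))))⁻¹)
      atTop
      (𝓝 ((det (Matrix.of fun i k : {i : Fin m // lam i = 0} =>
          C ((Uᵀ * S (Fin.last K₁).castSucc * U) i.1 k.1) + X * C ((Uᵀ * T 1 * U) i.1 k.1))).eval
            (v ^ (e 1 - e 0)) *
        ∏ i : {i : Fin m // ¬ lam i = 0}, lam i.1)) := by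
  set w : ℕ := e 1 - e 0 with hw
  set a : ℕ := d (Fin.last (K₁ + 1)) - d 0 with ha
  set a' : ℕ := d (Fin.last K₁).castSucc - d 0 with ha'
  set g : ℕ := d (Fin.last (K₁ + 1)) - d (Fin.last K₁).castSucc with hg
  set I : ℕ := m * a with hI
  set J : ℕ := m * (e (Fin.last (K₂ + 1)) - e 0) with hJdef
  set F : ℕ → ℕ → ℝ := fun i j => ((det H).coeff i).coeff j with hFdef
  have hF : ∀ i j, F i j = ((det H).coeff i).coeff j := fun i j => rfl
  have hlim := seam_scaled_det_tendsto K₁ K₂ d S e T U lam hd he hU hJ v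
  rw [← det_Ninf]
  refine (hlim.congr' ?_)
  filter_upwards [eventually_gt_atTop 0] with z hz
  have hz0 : z ≠ 0 := hz.ne'
  -- the determinant as the double sum of coefficients
  have hdet := eval_G_sum (K₁ + 1) (K₂ + 1) d S e T H hH F hF hd.monotone he.monotone (z ^ w) ((z ^ g)⁻¹ * v)
  rw [eval_G_det (K₁ + 1) (K₂ + 1) d S e T H hH] at hdet
  rw [hdet, Finset.prod_inv_distrib, Finset.prod_pow_eq_pow_sum, ← Finset.mul_sum, Finset.mul_sum, Finset.sum_mul]
  refine Finset.sum_congr rfl fun i _ => ?_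
  rw [Finset.mul_sum, Finset.sum_mul]
  refine Finset.sum_congr rfl fun j hj => ?_
  have hjJ : j ≤ J := Nat.lt_succ_iff.1 (mem_range.1 hj)
  -- `F v^j (z^{-g})^j (z^w)^i · z^{-w n₀} = F v^j z^{w i + g (J - j)} · z^{-(w n₀ + g J)}`
  have hsplit : g * J = g * (J - j) + g * j := by rw [← mul_add, Nat.sub_add_cancel hjJ]
  rw [hsplit, mul_pow, inv_pow, ← pow_mul, ← pow_mul, pow_add, pow_add, pow_add]
  field_simp
  ring

end Seam

end Summit.ValiantsHypothesis.ValiantsHypothesis.Theorems.LacunarySymmetroidMatrixDescartes.JunctionCeiling
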